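import Summits.Ventures.HodgeRepro2.A2PositiveDifference

/-!
# Lange E25 «positive line bundle := H positive definite», read on the alternating side

Blind cell pub-hodge-repro2, seat p6 (sub-claim A2 annex, Tier 4). Imports my rows 73 (`A2HermitianFromAlternating`:
Lange Lemma 1.2.10) and 76 (`A2PositiveDifference`: `IsPosDef`).

PRINTED INPUTS (held `book:lange1992-complex-abelian-varieties`): Lemma 1.2.10 (p0035 ll. 1–4, row 73) and the A2
external-facts row E25 (p0054 l. 1: a line bundle is positive iff its hermitian form H is positive definite;
non-degenerate). Remark A4.2.8 of route/T4-A2-p6.md uses the positivity of the Riemann form of the F-compatible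
polarisation in this form.

WHAT IS PROVED HERE (V a complex inner product space; nothing geometric):
* `IsRiemannAlt.IsPos E` — the positivity condition on the alternating side: `0 < E(iv, v)` for `v ≠ 0`.
* `re_hermOfAlt_self` — `Re H(v, v) = E(iv, v)` for `H = hermOfAlt E`: the real part of Lange's `H` is the symmetric
  form `g(v, w) = E(iv, w)` (`re_hermOfAlt`, row 73), so «H positive definite» is «g positive definite».
* **`isPosDef_hermOfAlt_iff`** — `hermOfAlt E` is positive definite iff `E` is positive (`E(iv, v) > 0`, `v ≠ 0`).
* **`isPos_altOfHerm_iff`** — `Im H` is positive iff `H` is positive definite.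
* `isHermitian_and_isPosDef_equiv` — the restriction of row 73's bijection `hermitianEquivRiemannAlt` to the positive
  definite forms on one side and the positive alternating forms on the other (E25 on both sides of Lemma 1.2.10).
What stays prose: the lattice Λ and the integrality `E(Λ, Λ) ⊂ ℤ` (E24), i.e. the passage from forms to line bundles.
§8(d) declaration: uses an L-value-free non-vanishing device: NO.
-/

namespace Summit.Ventures.HodgeRepro2.A2RiemannPositivity

open Summit.Ventures.HodgeRepro2.A2HermitianFromAlternating
open Summit.Ventures.HodgeRepro2.A2PositiveDifference
open Complex

variable {V : Type*} [NormedAddCommGroup V] [InnerProductSpace ℂ V]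

/-- The positivity condition on the alternating side (Lange's «positive», E25, transported through Lemma 1.2.10):
`0 < E(iv, v)` for every `v ≠ 0`. -/
def IsRiemannAlt.IsPos (E : V → V → ℝ) : Prop := ∀ v : V, v ≠ 0 → 0 < E (I • v) v

/-- `Re (hermOfAlt E) (v, v) = E(iv, v)` (the symmetric form `g` of Lange's `H = g + iE`). -/
lemma re_hermOfAlt_self (E : V → V → ℝ) (v : V) : (hermOfAlt E v v).re = E (I • v) v :=
  re_hermOfAlt E v v

/-- **E25 on the alternating side**: `hermOfAlt E` is positive definite iff `E(iv, v) > 0` for all `v ≠ 0`. -/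
theorem isPosDef_hermOfAlt_iff (E : V → V → ℝ) : IsPosDef (hermOfAlt E) ↔ IsRiemannAlt.IsPos E := by
  constructor
  · intro h v hv
    have := h v hv
    rwa [re_hermOfAlt_self] at this
  · intro h v hv
    rw [re_hermOfAlt_self]
    exact h v hv

/-- `Im H` is positive iff the hermitian form `H` is positive definite (`Im H (iv, v) = Re H(v, v)` by
`H(iv, w) = i H(v, w)`). -/
theorem isPos_altOfHerm_iff {H : V → V → ℂ} (hH : IsHermitian H) :
    IsRiemannAlt.IsPos (altOfHerm H) ↔ IsPosDef H := by
  have key : ∀ v : V, altOfHerm H (I • v) v = (H v v).re := by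
    intro v
    simp only [altOfHerm]
    rw [hH.apply_I_smul_left]
    simp
  constructor
  · intro h v hv
    have := h v hv
    rwa [key] at this
  · intro h v hv
    rw [key]
    exact h v hv

/-- The bijection of Lemma 1.2.10 restricted to the positive forms: positive definite hermitian forms correspond to
alternating forms `E` with `E(iv, iw) = E(v, w)` and `E(iv, v) > 0` for `v ≠ 0` (E25 on both sides). -/
noncomputable def isHermitian_and_isPosDef_equiv :
    {H : V → V → ℂ // IsHermitian H ∧ IsPosDef H} ≃
      {E : V → V → ℝ // IsRiemannAlt E ∧ IsRiemannAlt.IsPos E} where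
  toFun H := ⟨altOfHerm H.1, isRiemannAlt_altOfHerm H.2.1, (isPos_altOfHerm_iff H.2.1).mpr H.2.2⟩
  invFun E := ⟨hermOfAlt E.1, isHermitian_hermOfAlt E.2.1, (isPosDef_hermOfAlt_iff E.1).mpr E.2.2⟩
  left_inv H := Subtype.ext (hermOfAlt_altOfHerm H.2.1)
  right_inv E := Subtype.ext (altOfHerm_hermOfAlt E.1)

/-- Under the bijection, `E ↦ H = hermOfAlt E` — positivity of `E` at `v` is `Re H(v, v) > 0` (restated). -/
lemma isPos_iff_forall_re_pos (E : V → V → ℝ) :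
    IsRiemannAlt.IsPos E ↔ ∀ v : V, v ≠ 0 → 0 < (hermOfAlt E v v).re := by
  rw [← isPosDef_hermOfAlt_iff]; rfl

end Summit.Ventures.HodgeRepro2.A2RiemannPositivity
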